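import Summits.Ventures.CertifiedManyBodySolver.Downfold.PhaseMapTablePooling

/-!
# Distance to PASS: the arithmetic of «k more conversions / additions / decided members» behind a §7 floor

Venture CertifiedManyBodySolver, cell `pub/hubbard-downfold`, seat hubbard-downfold-score-1 (second scoring engine);
namespace `Summit.Ventures.CertifiedManyBodySolver.Downfold.CellScore.Tally`. Context: ACCEPTANCE §7 rung-1 clauses are ratio
floors `θ ≤ num/den` (R-score ≥ 0.90; decided fraction ≥ 0.90 / 0.60 per class; e-ph inside-band credit ≥ 0.80); both pens print
the MECHANICAL DISTANCE of a table to each floor in COUNTS — deputy-2's `NEEDLE-run<k>-*.md` («passes with 3 PARTIAL→AGREE …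
or with 25 new AGREE and NO new PARTIAL … every new PARTIAL costs 9 further AGREE») and score-1's `DISTANCE-TO-PASS.md`
(`tools/distance_to_pass.py`). Everything here is PROVED (ℕ arithmetic through `meets_div_iff` of `PhaseMapTablePooling`).

WHAT THIS IS NOT: not a plan and not a prediction — who can move a tally (router re-wording, a curated alternative, an e-ph band,
a box word) is the lead's / curators' / producers' business; this file only certifies what the printed counts MEAN:

* §1 the three moves on a tally `⟨num, den⟩`: `convert c` (c PARTIAL/DISAGREE/uncoded readings become AGREE, or c undecided
  members become decided: numerator + c, denominator fixed), `addAgree c` (c NEW readings that agree: numerator AND denominator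
  + c), `addMiss c` (c new readings that do not agree: denominator + c).
* §2 the tests in integers (`meets_convert_iff`, `meets_addAgree_iff`, `meets_addMiss_iff`: at θ = p/q the floor reads
  p·den' ≤ q·num'), monotonicity (`meets_convert_mono`: more conversions never hurt; `meets_addAgree_succ`: one more agreeing
  reading never hurts a floor θ ≤ 1; `meets_addMiss_anti`: one FEWER miss never hurts), and THE EXCHANGE RATE `meets_add_block`:
  a table meeting p/q still meets it after q new readings of which p agree — at 9/10, «every new PARTIAL costs 9 further AGREE».
* §3 numbers of record, RUN #10 = maps run-2026-08-27e (deputy-2 OF RECORD 02:44:08Z 08-27; both engines): v1 R 38/45 —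
  `run10_R_conversions` (2 conversions fail, 3 pass ⇒ 41/45), `run10_R_additions` (24 new AGREE fail, 25 pass ⇒ 63/70),
  `run10_R_pending_ceiling` (all 14 pending worded AGREE = 52/59 still FAILS; then 2 conversions pass at 54/59, 1 does not);
  class floors `run10_floor_cuprate` (1/19 at 0.60: 10 more decided fail, 11 pass), `run10_floor_nickelate` (0/4 at 0.60 after
  R44: 2 fail, 3 pass), `run10_floor_conventional` (2/7 at 0.90: 4 fail, 5 pass = 7/7; hydride 5/5; control-nonSC 3/3), e-ph
  credit `run10_eph_credit` (1/2 at 0.80: crediting the outside column passes at 2/2; by new credited columns alone 2 fail (3/4)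
  and 3 pass exactly (4/5)), v2 R `run10_v2_R` (3/5: 2 conversions pass; additions need 15), `run10_exchange_rate` (63/70 + ten
  readings: nine AGREE pass, eight fail).
-/

namespace Summit.Ventures.CertifiedManyBodySolver.Downfold

namespace CellScore

namespace Tally

/-! ## §1 The three moves -/

/-- `c` conversions: c scored-but-not-successful instances become successes (PARTIAL → AGREE; undecided member → decided):
numerator + c, denominator unchanged. [folklore] -/
def convert (t : Tally) (c : ℕ) : Tally := ⟨t.num + c, t.den⟩

/-- `c` additions that succeed (new materials worded AND agreeing; new credited band columns): numerator and denominator + c. [folklore] -/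
def addAgree (t : Tally) (c : ℕ) : Tally := ⟨t.num + c, t.den + c⟩

/-- `c` additions that fail (a new PARTIAL / DISAGREE / uncoded reading; a new banded column outside): denominator + c only. [folklore] -/
def addMiss (t : Tally) (c : ℕ) : Tally := ⟨t.num, t.den + c⟩

/-- Conversions compose additively. [folklore] -/
theorem convert_convert (t : Tally) (a b : ℕ) : (t.convert a).convert b = t.convert (a + b) := by
  simp only [convert, Nat.add_assoc]

/-- `addAgree c` is pooling with the all-success table `⟨c, c⟩`. [folklore] -/
theorem addAgree_eq_pool (t : Tally) (c : ℕ) : t.addAgree c = pool t ⟨c, c⟩ := rfl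

/-- `addMiss c` is pooling with the all-failure table `⟨0, c⟩`. [folklore] -/
theorem addMiss_eq_pool (t : Tally) (c : ℕ) : t.addMiss c = pool t ⟨0, c⟩ := by
  simp only [addMiss, pool, Nat.add_zero]

/-! ## §2 The floor after each move, in integers; monotonicity; the exchange rate -/

/-- After `c` conversions the floor p/q reads `p·den ≤ q·(num + c)`. [folklore] -/
theorem meets_convert_iff (p q : ℕ) (hq : 0 < q) (k n c : ℕ) :
    meets ((p : ℚ) / q) (convert ⟨k, n⟩ c) = true ↔ p * n ≤ q * (k + c) :=
  meets_div_iff p q hq (k + c) n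

/-- After `c` agreeing additions the floor p/q reads `p·(den + c) ≤ q·(num + c)`. [folklore] -/
theorem meets_addAgree_iff (p q : ℕ) (hq : 0 < q) (k n c : ℕ) :
    meets ((p : ℚ) / q) (addAgree ⟨k, n⟩ c) = true ↔ p * (n + c) ≤ q * (k + c) :=
  meets_div_iff p q hq (k + c) (n + c)

/-- After `c` failing additions the floor p/q reads `p·(den + c) ≤ q·num`. [folklore] -/
theorem meets_addMiss_iff (p q : ℕ) (hq : 0 < q) (k n c : ℕ) :
    meets ((p : ℚ) / q) (addMiss ⟨k, n⟩ c) = true ↔ p * (n + c) ≤ q * k :=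
  meets_div_iff p q hq k (n + c)

/-- More conversions never hurt (any θ ≥ 0): if `c` conversions meet the floor, so do `c' ≥ c`. [folklore] -/
theorem meets_convert_mono (θ : ℚ) (hθ : 0 ≤ θ) (t : Tally) (c c' : ℕ) (hcc : c ≤ c')
    (h : meets θ (t.convert c) = true) : meets θ (t.convert c') = true := by
  rw [meets_eq_true_iff] at h ⊢
  have _ := hθ
  have hc : ((t.num + c : ℕ) : ℚ) ≤ ((t.num + c' : ℕ) : ℚ) := by exact_mod_cast Nat.add_le_add_left hcc t.num
  simp only [convert] at h ⊢
  exact le_trans h hc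

/-- One more agreeing reading never hurts a floor θ ≤ 1 (the new instance pools in at ratio 1 ≥ θ). [folklore] -/
theorem meets_addAgree_succ (θ : ℚ) (hθ1 : θ ≤ 1) (t : Tally) (c : ℕ)
    (h : meets θ (t.addAgree c) = true) : meets θ (t.addAgree (c + 1)) = true := by
  have e : t.addAgree (c + 1) = pool (t.addAgree c) ⟨1, 1⟩ := by
    simp only [addAgree, pool, Nat.add_assoc]
  rw [e]
  refine meets_pool θ _ _ h ?_
  rw [meets_eq_true_iff]; push_cast; linarith

/-- Hence any number of further agreeing readings keeps a met floor θ ≤ 1 met. [folklore] -/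
theorem meets_addAgree_mono (θ : ℚ) (hθ1 : θ ≤ 1) (t : Tally) (c d : ℕ)
    (h : meets θ (t.addAgree c) = true) : meets θ (t.addAgree (c + d)) = true := by
  induction d with
  | zero => simpa using h
  | succ d ih => simpa [Nat.add_assoc] using meets_addAgree_succ θ hθ1 t (c + d) ih

/-- One FEWER failing addition never hurts (θ ≥ 0): if the floor survives `c + 1` misses it survives `c`. [folklore] -/
theorem meets_addMiss_anti (θ : ℚ) (hθ : 0 ≤ θ) (t : Tally) (c : ℕ)
    (h : meets θ (t.addMiss (c + 1)) = true) : meets θ (t.addMiss c) = true := by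
  rw [meets_eq_true_iff] at h ⊢
  simp only [addMiss] at h ⊢
  have hd : ((t.den + c : ℕ) : ℚ) ≤ ((t.den + (c + 1) : ℕ) : ℚ) := by exact_mod_cast (by omega : t.den + c ≤ t.den + (c + 1))
  nlinarith

/-- THE EXCHANGE RATE: a table meeting p/q still meets it after q new readings of which exactly p agree — the block `⟨p, q⟩` meets
p/q itself, and two passing tables pool to a pass. At 9/10: 10 new readings with 9 AGREE keep the floor; read the other way,
«every new PARTIAL costs 9 further AGREE to stay level» (deputy-2 NEEDLE). [folklore] -/
theorem meets_add_block (p q : ℕ) (hq : 0 < q) (k n : ℕ) (h : meets ((p : ℚ) / q) ⟨k, n⟩ = true) :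
    meets ((p : ℚ) / q) ⟨k + p, n + q⟩ = true := by
  have hb : meets ((p : ℚ) / q) ⟨p, q⟩ = true := (meets_div_iff p q hq p q).mpr (by rw [Nat.mul_comm])
  exact meets_pool _ _ _ h hb

/-- … and the exchange rate is exact: with ONE agree short of the block (p − 1 of q, p ≥ 1) a table that met the floor with no
slack (p·n = q·k) fails it. [folklore] -/
theorem block_short_fails (p q : ℕ) (hq : 0 < q) (k n : ℕ) (hp : 1 ≤ p) (htight : p * n = q * k) :
    meets ((p : ℚ) / q) ⟨k + (p - 1), n + q⟩ = false := by
  rw [Bool.eq_false_iff]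
  intro h
  rw [meets_div_iff p q hq] at h
  have : p * (n + q) ≤ q * (k + (p - 1)) := h
  have h2 : q * (k + (p - 1)) + q = q * k + q * p := by
    rw [Nat.mul_add, Nat.add_assoc, ← Nat.mul_succ, Nat.succ_eq_add_one, Nat.sub_add_cancel hp]
  nlinarith [Nat.mul_comm p q]

/-! ## §3 Numbers of record — RUN #10 (maps run-2026-08-27e; ACCEPTANCE v1.7/v1.8; both engines, pen parity 0/0) -/

/-- v1 R-score 38/45 at 0.90: two PARTIAL → AGREE conversions give 40/45 and FAIL; three give 41/45 and PASS (9·45 = 405 ≤ 410). [folklore] -/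
theorem run10_R_conversions :
    meets (9 / 10) (convert ⟨38, 45⟩ 2) = false ∧ meets (9 / 10) (convert ⟨38, 45⟩ 3) = true := by
  constructor
  · rw [meets_eq_false_iff]; norm_num [convert]
  · rw [meets_eq_true_iff]; norm_num [convert]

/-- v1 R by additions alone: 24 new AGREE (62/69) FAIL, 25 (63/70) PASS exactly (9·70 = 630 = 10·63). [folklore] -/
theorem run10_R_additions :
    meets (9 / 10) (addAgree ⟨38, 45⟩ 24) = false ∧ meets (9 / 10) (addAgree ⟨38, 45⟩ 25) = true := by
  constructor
  · rw [meets_eq_false_iff]; norm_num [addAgree]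
  · rw [meets_eq_true_iff]; norm_num [addAgree]

/-- v1 R ceiling by wording: all 14 pending materials worded AND agreeing = 52/59 still FAILS (0.881); from there 1 conversion
(53/59) fails and 2 (54/59) pass — «at least two conversions in every scenario» (DISTANCE-TO-PASS). [folklore] -/
theorem run10_R_pending_ceiling :
    meets (9 / 10) (addAgree ⟨38, 45⟩ 14) = false ∧
      meets (9 / 10) ((addAgree ⟨38, 45⟩ 14).convert 1) = false ∧ meets (9 / 10) ((addAgree ⟨38, 45⟩ 14).convert 2) = true := by
  refine ⟨?_, ?_, ?_⟩
  · rw [meets_eq_false_iff]; norm_num [addAgree]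
  · rw [meets_eq_false_iff]; norm_num [addAgree, convert]
  · rw [meets_eq_true_iff]; norm_num [addAgree, convert]

/-- Cuprate decided fraction 1/19 at 0.60: 10 more decided (11/19) FAIL, 11 more (12/19) PASS (3·19 = 57 ≤ 60). [folklore] -/
theorem run10_floor_cuprate :
    meets (3 / 5) (convert ⟨1, 19⟩ 10) = false ∧ meets (3 / 5) (convert ⟨1, 19⟩ 11) = true := by
  constructor
  · rw [meets_eq_false_iff]; norm_num [convert]
  · rw [meets_eq_true_iff]; norm_num [convert]

/-- Nickelate 0/4 at 0.60 (denominator 4 after the R44 honest abstentions M23/M24/M40): 2 decided FAIL, 3 PASS. [folklore] -/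
theorem run10_floor_nickelate :
    meets (3 / 5) (convert ⟨0, 4⟩ 2) = false ∧ meets (3 / 5) (convert ⟨0, 4⟩ 3) = true := by
  constructor
  · rw [meets_eq_false_iff]; norm_num [convert]
  · rw [meets_eq_true_iff]; norm_num [convert]

/-- Conventional 2/7 at 0.90: 4 more decided (6/7) FAIL, 5 more (7/7) PASS — the 0.90 floor on 7 members means ALL of them;
likewise hydride 0/5 needs 5/5 and control-nonSC 0/3 (after R44 M49) needs 3/3. [folklore] -/
theorem run10_floor_conventional :
    meets (9 / 10) (convert ⟨2, 7⟩ 4) = false ∧ meets (9 / 10) (convert ⟨2, 7⟩ 5) = true ∧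
      meets (9 / 10) (convert ⟨0, 5⟩ 4) = false ∧ meets (9 / 10) (convert ⟨0, 5⟩ 5) = true ∧
      meets (9 / 10) (convert ⟨0, 3⟩ 2) = false ∧ meets (9 / 10) (convert ⟨0, 3⟩ 3) = true := by
  refine ⟨?_, ?_, ?_, ?_, ?_, ?_⟩ <;>
    first
    | (rw [meets_eq_false_iff]; norm_num [convert])
    | (rw [meets_eq_true_iff]; norm_num [convert])

/-- e-ph inside-band credit 1/2 at 0.80: crediting the one outside column (Nb) passes at 2/2; by NEW credited columns alone
(the outside column staying) 2 more (3/4) FAIL and 3 more (4/5) PASS exactly (4·5 = 20 = 5·4) — «k of n needs 4n ≤ 5k». [folklore] -/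
theorem run10_eph_credit :
    meets (4 / 5) (convert ⟨1, 2⟩ 1) = true ∧
      meets (4 / 5) (addAgree ⟨1, 2⟩ 2) = false ∧ meets (4 / 5) (addAgree ⟨1, 2⟩ 3) = true := by
  refine ⟨?_, ?_, ?_⟩
  · rw [meets_eq_true_iff]; norm_num [convert]
  · rw [meets_eq_false_iff]; norm_num [addAgree]
  · rw [meets_eq_true_iff]; norm_num [addAgree]

/-- v2 table R 3/5 at 0.90 (M59, M69 AGREE; M67 PdH, M68 LuH₂ PARTIAL): 1 conversion (4/5) FAILS, 2 (5/5) PASS; by additions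
alone 14 new AGREE (17/19) FAIL and 15 (18/20) PASS exactly. [folklore] -/
theorem run10_v2_R :
    meets (9 / 10) (convert ⟨3, 5⟩ 1) = false ∧ meets (9 / 10) (convert ⟨3, 5⟩ 2) = true ∧
      meets (9 / 10) (addAgree ⟨3, 5⟩ 14) = false ∧ meets (9 / 10) (addAgree ⟨3, 5⟩ 15) = true := by
  refine ⟨?_, ?_, ?_, ?_⟩
  · rw [meets_eq_false_iff]; norm_num [convert]
  · rw [meets_eq_true_iff]; norm_num [convert]
  · rw [meets_eq_false_iff]; norm_num [addAgree]
  · rw [meets_eq_true_iff]; norm_num [addAgree]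

/-- The exchange rate at the R floor, on the numbers of record: from the exactly-passing 63/70, ten more readings with nine
AGREE (72/80) still pass, with eight AGREE (71/80) fail. [folklore] -/
theorem run10_exchange_rate :
    meets (9 / 10) ⟨63 + 9, 70 + 10⟩ = true ∧ meets (9 / 10) ⟨63 + 8, 70 + 10⟩ = false := by
  constructor
  · exact_mod_cast meets_add_block 9 10 (by norm_num) 63 70 (by rw [meets_eq_true_iff]; norm_num)
  · exact_mod_cast block_short_fails 9 10 (by norm_num) 63 70 (by norm_num) (by norm_num)

end Tally

end CellScore

end Summit.Ventures.CertifiedManyBodySolver.Downfold
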